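import Summits.Ventures.Crystal3D.Theorems.StickyWulffConstantNoReconstructionGainBarlowGrainFilm
import HarnessLib

/-!
# Misoriented Barlow grains: the basal DOUBLE cone (rung `barlowGrainFilm_slab_abs`)

HONEST FRAMING. Part of the venture `Summits/Ventures/Crystal3D` (cell `crystal3d-full`), helper
`--supports` the crux `NoReconstructionGain` (stmt-Ventures-19144, route
`route-Ventures-StickyWulffConstant`), line `adhesion` (wulff-p1 g13).  The rung `barlowGrainFilm_slab`
(`…BarlowGrainFilm`) asks the moved stacking axis `A e₃` to lie in the UPPER basal cone
(`⟪ν, A e₃⟫ > 1/√3`).  The geometric class — basal planes tilted by less than `54.7°` from the cut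
plane — is the DOUBLE cone `|⟪ν, A e₃⟫| > 1/√3`; the lower cone is the upper cone of the same point
set read backwards: the basal mirror `M` maps `barlowStacking 1 √(2/3) σ` onto the stacking of the
REVERSED Hägg word `n ↦ −σ(−n−1)` (layer `k ↦ −k`, same letters), so
`A · 𝓑_σ + c = (A M) · 𝓑_{σ'} + c` with `⟪ν, A M e₃⟫ = −⟪ν, A e₃⟫`.

* `isHaggSeq_reverse`, `haggLabel_reverse` — the reversed word is a Hägg word with labels
  `L'(−k) = L(k)`;
* `basalMirror_barlowPos_eq_reverse` — `M (pos_σ k i j) = pos_{σ'} (−k) i j`;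
* `reversed_axis_tilt`, `reversed_grain_mem` — reading a grain in the lower cone
  `⟪ν, A e₃⟫ < −1/√3` as the reversed stacking moved by `A M`, whose axis is in the upper cone;
* `barlowGrainFilm_slab_abs` (**rung, registered by name on stmt-Ventures-19144**) — the rung for
  the double cone `1/√3 < |⟪ν, A e₃⟫|`: misoriented grains of ANY Barlow stacking whose basal plane
  is tilted by less than `54.7°` from the cut plane gain nothing, at every normal (constants of
  `barlowGrainFilm_slab`).

WHAT THIS IS NOT: the crux; tilts `≥ 54.7°` (`|⟪ν, A e₃⟫| ≤ 1/√3`) remain open for non-fcc polytypes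
(bilayer pairing); rung F-C1 not moved.
-/

noncomputable section

namespace Summit.Ventures.Crystal3D.Theorems

open Summit.Ventures.Crystal3D Finset
open Literature.MathematicalPhysics.StatisticalMechanics (fccStacking barlowStacking barlowPos constHagg
  haggLabel IsHaggSeq contactDeficiency barlowPos_apply_zero barlowPos_apply_one barlowPos_apply_two
  haggLabel_zero haggLabel_succ mem_barlowStacking_iff)
open scoped InnerProductSpace

/-! ### The reversed Hägg word -/

/-- The reversed word `n ↦ −σ(−n−1)` of a Hägg word is a Hägg word. -/
theorem isHaggSeq_reverse {σ : ℤ → ℤ} (hσ : IsHaggSeq σ) : IsHaggSeq fun n => -σ (-n - 1) := by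
  intro n
  rcases hσ (-n - 1) with h | h <;> simp [h]

/-- **Labels of the reversed word:** `L'(−k) = L(k)`. -/
theorem haggLabel_reverse (σ : ℤ → ℤ) (k : ℤ) :
    haggLabel (fun n => -σ (-n - 1)) (-k) = haggLabel σ k := by
  induction k using Int.induction_on with
  | zero => simp
  | succ k ih =>
    -- `L'(-k) = L'(-(k+1)) + σ'(-(k+1))` and `L(k+1) = L(k) + σ k`
    have h1 := haggLabel_succ (fun n => -σ (-n - 1)) (-((k : ℤ) + 1))
    rw [show -((k : ℤ) + 1) + 1 = -(k : ℤ) by ring, ih] at h1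
    have h2 : -σ (-(-((k : ℤ) + 1)) - 1) = -σ k := by
      congr 2; ring
    rw [h2] at h1
    rw [haggLabel_succ]
    linarith
  | pred k ih =>
    -- `L'(k+1) = L'(k) + σ'(k)` and `L(-k) = L(-k-1) + σ(-k-1)`
    have h1 := haggLabel_succ (fun n => -σ (-n - 1)) (k : ℤ)
    rw [show -(-(k : ℤ)) = (k : ℤ) by ring] at ih
    rw [show -(-(k : ℤ) - 1) = (k : ℤ) + 1 by ring, h1, ih]
    have h2 := haggLabel_succ σ (-(k : ℤ) - 1)
    rw [show -(k : ℤ) - 1 + 1 = -(k : ℤ) by ring] at h2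
    rw [h2]
    ring

/-- **The basal mirror reverses the stacking:** `M (pos_σ k i j) = pos_{σ'} (−k) i j`. -/
theorem basalMirror_barlowPos_eq_reverse (σ : ℤ → ℤ) (k i j : ℤ) :
    (ℝ ∙ (EuclideanSpace.single (2 : Fin 3) (1 : ℝ)))ᗮ.reflection (barlowPos 1 (Real.sqrt (2 / 3)) σ k i j) =
      barlowPos 1 (Real.sqrt (2 / 3)) (fun n => -σ (-n - 1)) (-k) i j := by
  have hL := haggLabel_reverse σ k
  ext l
  fin_cases l
  · simp [basalMirror_apply_zero, barlowPos_apply_zero, hL]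
  · simp [basalMirror_apply_one, barlowPos_apply_one, hL]
  · simp [basalMirror_apply_two, barlowPos_apply_two]

/-- The basal mirror flips the axis: `M e₃ = −e₃`. -/
theorem basalMirror_e3 :
    (ℝ ∙ (EuclideanSpace.single (2 : Fin 3) (1 : ℝ)))ᗮ.reflection (EuclideanSpace.single (2 : Fin 3) (1 : ℝ)) =
      -EuclideanSpace.single (2 : Fin 3) (1 : ℝ) :=
  Submodule.reflection_orthogonalComplement_singleton_eq_neg _

/-! ### The lower cone and the double cone -/

/-- Reading a grain backwards, I: the axis of `A M` lies in the upper cone when the axis of `A` lies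
in the lower cone. -/
theorem reversed_axis_tilt (A : EuclideanSpace ℝ (Fin 3) ≃ₗᵢ[ℝ] EuclideanSpace ℝ (Fin 3))
    (ν : EuclideanSpace ℝ (Fin 3))
    (h : ⟪ν, A (EuclideanSpace.single (2 : Fin 3) (1 : ℝ))⟫_ℝ < -(1 / Real.sqrt 3)) :
    1 / Real.sqrt 3 <
      ⟪ν, (((ℝ ∙ (EuclideanSpace.single (2 : Fin 3) (1 : ℝ)))ᗮ.reflection).trans A)
        (EuclideanSpace.single (2 : Fin 3) (1 : ℝ))⟫_ℝ := by
  rw [LinearIsometryEquiv.trans_apply, basalMirror_e3, map_neg, inner_neg_right]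
  linarith

/-- Reading a grain backwards, II: `A · 𝓑_σ + c = (A M) · 𝓑_{σ'} + c` pointwise. -/
theorem reversed_grain_mem {σ : ℤ → ℤ} (A : EuclideanSpace ℝ (Fin 3) ≃ₗᵢ[ℝ] EuclideanSpace ℝ (Fin 3))
    (c q : EuclideanSpace ℝ (Fin 3))
    (hq : q ∈ (fun p => A p + c) '' barlowStacking 1 (Real.sqrt (2 / 3)) σ) :
    q ∈ (fun p => (((ℝ ∙ (EuclideanSpace.single (2 : Fin 3) (1 : ℝ)))ᗮ.reflection).trans A) p + c) ''
      barlowStacking 1 (Real.sqrt (2 / 3)) (fun n => -σ (-n - 1)) := by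
  obtain ⟨b, hb, hbq⟩ := hq
  obtain ⟨k, i, j, rfl⟩ := mem_barlowStacking_iff.1 hb
  refine ⟨(ℝ ∙ (EuclideanSpace.single (2 : Fin 3) (1 : ℝ)))ᗮ.reflection (barlowPos 1 (Real.sqrt (2 / 3)) σ k i j),
    ?_, ?_⟩
  · rw [basalMirror_barlowPos_eq_reverse]; exact ⟨-k, i, j, rfl⟩
  · simp only [LinearIsometryEquiv.trans_apply, Submodule.reflection_reflection]; exact hbq

/-- **RUNG (registered by name on stmt-Ventures-19144): misoriented grains of ANY Barlow stacking
whose basal plane is tilted by less than `54.7°` from the cut plane gain nothing, at every normal** —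
the basal DOUBLE cone `1/√3 < |⟪ν, A e₃⟫|`.  For every Hägg word `σ`, linear isometry `A`, shift
`c`, unit normal `ν` and `ρ ≥ R`: a finite unit packing `X ⊇ P` (the fcc slab sample) whose film balls
lie above the cut, off `Λ₀`, and inside `A · barlowStacking 1 √(2/3) σ + c`, satisfies
`#cross(P, X∖P) ≤ D(X∖P) + C ρ` (constants of `barlowGrainFilm_slab`).  In the lower cone the grain
is read as the moved stacking of the reversed Hägg word under `A M`. -/
theorem barlowGrainFilm_slab_abs :
    ∃ R C : ℝ, 1 ≤ R ∧ ∀ σ : ℤ → ℤ, IsHaggSeq σ →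
      ∀ (A : EuclideanSpace ℝ (Fin 3) ≃ₗᵢ[ℝ] EuclideanSpace ℝ (Fin 3)) (c : EuclideanSpace ℝ (Fin 3)),
      ∀ ν : EuclideanSpace ℝ (Fin 3), ‖ν‖ = 1 →
      1 / Real.sqrt 3 < |⟪ν, A (EuclideanSpace.single (2 : Fin 3) (1 : ℝ))⟫_ℝ| →
      ∀ ρ : ℝ, R ≤ ρ →
      ∀ X P : Finset (EuclideanSpace ℝ (Fin 3)),
      (∀ p ∈ X, ∀ q ∈ X, p ≠ q → 1 ≤ dist p q) → P ⊆ X →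
      (∀ p, p ∈ P ↔ (p ∈ fccStacking 1 (Real.sqrt (2 / 3)) ∧ -(2 * R) ≤ ⟪p, ν⟫_ℝ ∧
        ⟪p, ν⟫_ℝ ≤ -R ∧ ‖p‖ ^ 2 - ⟪p, ν⟫_ℝ ^ 2 ≤ ρ ^ 2)) →
      (∀ q ∈ X \ P, -R < ⟪q, ν⟫_ℝ) →
      (∀ q ∈ X \ P, q ∉ fccStacking 1 (Real.sqrt (2 / 3))) →
      (∀ q ∈ X \ P, q ∈ (fun p => A p + c) '' barlowStacking 1 (Real.sqrt (2 / 3)) σ) →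
      ((((P ×ˢ (X \ P)).filter fun pq => dist pq.1 pq.2 = 1).card : ℕ) : ℝ) ≤
        contactDeficiency (X \ P) + C * ρ := by
  obtain ⟨R, C, hR, h⟩ := barlowGrainFilm_slab
  refine ⟨R, C, hR, ?_⟩
  intro σ hσ A c ν hν htilt ρ hρ X P hX hPX hP habove hoff hgrain
  rcases lt_abs.1 htilt with hpos | hneg
  · exact h σ hσ A c ν hν hpos ρ hρ X P hX hPX hP habove hoff hgrain
  · have hlt : ⟪ν, A (EuclideanSpace.single (2 : Fin 3) (1 : ℝ))⟫_ℝ < -(1 / Real.sqrt 3) := by linarith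
    exact h _ (isHaggSeq_reverse hσ) _ c ν hν (reversed_axis_tilt A ν hlt) ρ hρ X P hX hPX hP habove hoff
      fun q hq => reversed_grain_mem A c q (hgrain q hq)

end Summit.Ventures.Crystal3D.Theorems

end
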